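import Summits.BirchSwinnertonDyer.BirchSwinnertonDyer.Theorems.ResidualThetaTransportAtTwoThetaLayerLambdaCongruenceAtTwoCuspSpanCosetPairs
import Summits.BirchSwinnertonDyer.BirchSwinnertonDyer.Theorems.ResidualThetaTransportAtTwoThetaLayerLambdaCongruenceAtTwoCuspSpanCharacterSums
import HarnessLib

/-!
# Route `ResidualThetaTransportAtTwo`, cruxes Kan⁺ (stmt-BirchSwinnertonDyer-20688) / node 27436 / 21437: **the node at every odd prime
# of small index** — `CuspSpanEvenAtTwo p` whenever `p` is large against `n := [𝔽ₚˣ : ⟨4, −1⟩]` (Jacobi sums)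

Cell `bsd-wall`, width seat `bsd-wall-rtt-p3-w5` g2 (2026-08-28); the lead's (rtt-p3 g9) successor item (3) «Theorem C large-subgroup regime
via Mathlib `jacobiSum`». THEOREMS ONLY; `--supports stmt-BirchSwinnertonDyer-20688`. BSD is not proved by this; at the primes NOT covered
(small `⟨4⟩`: `17, 41, 109, 113, 127, 157, 241, 257, 277, 331, 337, …`) the node stays a hypothesis unless a certificate exists.

THEOREM (`cuspSpanEvenAtTwo_of_index_le`). Let `p` be an odd prime, `H := ⟨4, −1⟩ ≤ 𝔽ₚˣ`, `[𝔽ₚˣ : H] ≤ n`. If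
`3(n − 1) + 2 < p` and `((n − 1)(n − 2))² · p < (p − 2 − 3(n − 1))²` (i.e. `p − 2 − 3(n−1) > (n−1)(n−2)√p`; roughly `p > n⁴`), then
`CuspSpanEvenAtTwo p`.

PROOF. (i) `…CuspSpanCharacterSums.exists_mem_coset_pair`: with `X := H^⊥ ⊂ Hom(𝔽ₚˣ, ℂˣ)` (Mathlib's
`MulChar.subgroupOrderIsoSubgroupMulChar`; `#X = n`), for all units `a, b` some `h₁, h₂ ∈ H` have `a h₁ + b h₂ = 1` — the cyclotomic
number `#{v ∈ aH : 1 − v ∈ bH}` has the Jacobi-sum expansion `n⁻² Σ_{χ,ψ ∈ X} χ(a⁻¹)ψ(b⁻¹) J(χ,ψ)` with main term `J(1,1) = p − 2` and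
the other terms of norm `1` (`3(n−1)` of them) or `√p` (`(n−1)(n−2)` of them). (ii) Elements of `H` are `±4^k`
(`exists_eq_pm_four_pow_of_mem_closure`), so every pair of cosets is realised by some `(u, u − 1)`; (iii) the coset-pair criterion
`cuspSpanEvenAtTwo_of_cosetPairs` (`…CuspSpanCosetPairs`: Manin's three-term rule + 4-invariance (lead, p628791) + sign companion
(p636044) ⟹ Theorem C⁻(p) ⟹ (G″)_p ⟹ node).

SCOPE (numbers, seat script `analysis/paircond.py`): the inequality holds at 176 of the 210 odd primes `< 1300` (all with `n ≤ 8` and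
`p ≥ 881`, …); for each fixed index `n` it holds for every `p > (3 + (n−1)(n−2))² + …`, e.g. `n = 1, 2`: all `p ≥ 7`; `n = 3`: `p ≥ 17`;
`n = 4`: `p ≥ 59`; `n = 6`: `p > 420`; `n = 8`: `p > 1800`. Under GRH (Hooley) the index of `2` is bounded on a density-one set of primes, so
this theorem covers a density-one set of prime levels; unconditionally it covers every prime with `ord_p 4 ≳ p^{3/4}`.
Instances: the index bound `hn` is discharged per level from `orderOf (4 : ZMod p)` (companion file `…CuspSpanJacobiLevels`); the
inequality is monotone in `n` (`jacobi_ineq_mono`), so an upper bound on the index suffices.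

References: K. Ireland, M. Rosen, GTM 84, Ch. 8; A. Weil, Bull. AMS 55 (1949); C. Hooley, J. reine angew. Math. 225 (1967) (Artin under GRH);
[Manin1972] §1.5; [Pollack2003] Conj. 6.3.
-/

set_option autoImplicit false
set_option linter.dupNamespace false

open scoped MatrixGroups

open CongruenceSubgroup

namespace Summit.BirchSwinnertonDyer.BirchSwinnertonDyer.Theorems.SignedMuAtTwo

variable {p : ℕ} [Fact p.Prime]

/-- Elements of `⟨4, −1⟩ ≤ 𝔽ₚˣ` are `±4^k`. [folklore] -/
theorem exists_eq_pm_four_pow_of_mem_closure (hp2 : p ≠ 2) {u : (ZMod p)ˣ}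
    (hu : u ∈ Subgroup.closure {w : (ZMod p)ˣ | (w : ZMod p) = 4 ∨ (w : ZMod p) = -1}) :
    ∃ k : ℕ, (u : ZMod p) = 4 ^ k ∨ (u : ZMod p) = -(4 ^ k) := by
  have hp : p.Prime := Fact.out
  have h40 : (4 : ZMod p) ≠ 0 := by
    intro h0
    have h0' : ((4 : ℕ) : ZMod p) = 0 := by exact_mod_cast h0
    have h4 : p ∣ 2 ^ 2 := by norm_num; exact (ZMod.natCast_eq_zero_iff 4 p).mp h0'
    exact hp2 ((Nat.prime_dvd_prime_iff_eq hp Nat.prime_two).mp (hp.dvd_of_dvd_pow h4))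
  induction hu using Subgroup.closure_induction with
  | mem w hw =>
    rcases hw with hw | hw
    · exact ⟨1, Or.inl (by rw [hw, pow_one])⟩
    · exact ⟨0, Or.inr (by rw [hw, pow_zero])⟩
  | one => exact ⟨0, Or.inl (by rw [Units.val_one, pow_zero])⟩
  | mul x y _ _ hx hy =>
    obtain ⟨i, hi⟩ := hx
    obtain ⟨j, hj⟩ := hy
    refine ⟨i + j, ?_⟩
    rw [Units.val_mul, pow_add]
    rcases hi with hi | hi <;> rcases hj with hj | hj <;> rw [hi, hj]
    · left; ring
    · right; ring
    · right; ring
    · left; ring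
  | inv x _ hx =>
    obtain ⟨i, hi⟩ := hx
    refine ⟨i * (p - 2), ?_⟩
    have h4 : (4 : ZMod p) ^ i * 4 ^ (i * (p - 2)) = 1 := by
      have hp1 : p - 2 + 1 = p - 1 := by have := hp.two_le; omega
      have e : i + i * (p - 2) = (p - 1) * i := by
        rw [← hp1]; ring
      rw [← pow_add, e, pow_mul, ZMod.pow_card_sub_one_eq_one h40, one_pow]
    rw [Units.val_inv_eq_inv_val]
    rcases hi with hi | hi <;> rw [hi]
    · left; exact inv_eq_of_mul_eq_one_right h4
    · right
      rw [inv_neg]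
      exact congrArg Neg.neg (inv_eq_of_mul_eq_one_right h4)

/-- The numeric hypothesis is monotone in the index: if it holds for `n` it holds for every `k ≤ n`. [folklore] -/
theorem jacobi_ineq_mono {p k n : ℕ} (hkn : k ≤ n)
    (h : 3 * (n - 1) + 2 < p ∧ ((n - 1) * (n - 2)) ^ 2 * p < (p - 2 - 3 * (n - 1)) ^ 2) :
    3 * (k - 1) + 2 < p ∧ ((k - 1) * (k - 2)) ^ 2 * p < (p - 2 - 3 * (k - 1)) ^ 2 := by
  obtain ⟨h1, h2⟩ := h
  have hk1 : k - 1 ≤ n - 1 := Nat.sub_le_sub_right hkn 1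
  have hk2 : k - 2 ≤ n - 2 := Nat.sub_le_sub_right hkn 2
  refine ⟨by omega, ?_⟩
  calc ((k - 1) * (k - 2)) ^ 2 * p ≤ ((n - 1) * (n - 2)) ^ 2 * p :=
        Nat.mul_le_mul_right _ (Nat.pow_le_pow_left (Nat.mul_le_mul hk1 hk2) 2)
    _ < (p - 2 - 3 * (n - 1)) ^ 2 := h2
    _ ≤ (p - 2 - 3 * (k - 1)) ^ 2 := Nat.pow_le_pow_left (by omega) 2

/-- **The node at every odd prime of small index (Jacobi sums).** Let `H := ⟨4, −1⟩ ≤ 𝔽ₚˣ` have index `≤ n`. If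
`3(n−1) + 2 < p` and `((n−1)(n−2))² p < (p − 2 − 3(n−1))²` then `CuspSpanEvenAtTwo p`. [cite: Pollack2003, Conj. 6.3]
[cite: Manin1972, §1.5] -/
theorem cuspSpanEvenAtTwo_of_index_le (hp2 : p ≠ 2) {n : ℕ}
    (hn : (Subgroup.closure {w : (ZMod p)ˣ | (w : ZMod p) = 4 ∨ (w : ZMod p) = -1}).index ≤ n)
    (hineq : 3 * (n - 1) + 2 < p ∧ ((n - 1) * (n - 2)) ^ 2 * p < (p - 2 - 3 * (n - 1)) ^ 2) :
    CuspSpanEvenAtTwo p := by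
  classical
  set H : Subgroup (ZMod p)ˣ := Subgroup.closure {w : (ZMod p)ˣ | (w : ZMod p) = 4 ∨ (w : ZMod p) = -1} with hH
  -- the annihilator `X = H^⊥` of `H` in the group of `ℂ`-valued characters
  haveI : NeZero ((Monoid.exponent (ZMod p)ˣ : ℕ) : ℂ) := ⟨Nat.cast_ne_zero.mpr Monoid.exponent_ne_zero_of_finite⟩
  haveI : Fintype (MulChar (ZMod p) ℂ) := Fintype.ofFinite _
  set X₀ : Subgroup (MulChar (ZMod p) ℂ) :=
    OrderDual.ofDual (MulChar.subgroupOrderIsoSubgroupMulChar (ZMod p) ℂ H) with hX₀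
  set X : Finset (MulChar (ZMod p) ℂ) := Finset.univ.filter (· ∈ X₀) with hX
  have hmemX : ∀ χ, χ ∈ X ↔ χ ∈ X₀ := fun χ ↦ by simp [hX]
  have hone : (1 : MulChar (ZMod p) ℂ) ∈ X := (hmemX 1).mpr X₀.one_mem
  have hmul : ∀ χ ∈ X, ∀ ψ ∈ X, χ * ψ ∈ X := fun χ hχ ψ hψ ↦
    (hmemX _).mpr (X₀.mul_mem ((hmemX _).mp hχ) ((hmemX _).mp hψ))
  have hinv : ∀ χ ∈ X, χ⁻¹ ∈ X := fun χ hχ ↦ (hmemX _).mpr (X₀.inv_mem ((hmemX _).mp hχ))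
  have hsep : ∀ m : (ZMod p)ˣ, m ∉ H → ∃ χ ∈ X, χ (m : ZMod p) ≠ 1 := by
    intro m hm
    by_contra hcon
    push Not at hcon
    apply hm
    have h : m ∈ (MulChar.subgroupOrderIsoSubgroupMulChar (ZMod p) ℂ).symm (OrderDual.toDual X₀) :=
      MulChar.mem_subgroupOrderIsoSubgroupMulChar_symm_iff.mpr fun χ hχ ↦ hcon χ ((hmemX χ).mpr hχ)
    rwa [hX₀, OrderDual.toDual_ofDual, OrderIso.symm_apply_apply] at h
  have hcard : X.card = H.index := by
    have h1 := MulChar.card_subgroupOrderIsoSubgroupMulChar (M := ZMod p) (R := ℂ) (H := H)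
    rw [Subgroup.index, ← h1, ← hX₀, Nat.card_eq_fintype_card, ← Fintype.card_subtype]
  replace hineq := jacobi_ineq_mono (hcard ▸ hn) hineq
  refine cuspSpanEvenAtTwo_of_cosetPairs hp2 fun x y hx hy ↦ ?_
  obtain ⟨h₁, hh₁, h₂, hh₂, hsum⟩ := CharacterSums.exists_mem_coset_pair X H hone hmul hinv hsep hineq
    (Units.mk0 x hx) (Units.mk0 (x * y) (mul_ne_zero hx hy))
  rw [Units.val_mul, Units.val_mk0, Units.val_mul, Units.val_mk0] at hsum
  obtain ⟨k, hk⟩ := exists_eq_pm_four_pow_of_mem_closure hp2 hh₁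
  obtain ⟨l, hl⟩ := exists_eq_pm_four_pow_of_mem_closure hp2 hh₂
  have e : x * (h₁ : ZMod p) - 1 = -(x * y * (h₂ : ZMod p)) := by linear_combination hsum
  refine ⟨x * h₁, mul_ne_zero hx h₁.ne_zero, ?_, ⟨k, ?_⟩, ⟨l, ?_⟩⟩
  · rw [e]; exact neg_ne_zero.mpr (mul_ne_zero (mul_ne_zero hx hy) h₂.ne_zero)
  · rcases hk with hk | hk <;> rw [hk]
    · left; ring
    · right; ring
  · rw [e]
    rcases hl with hl | hl <;> rw [hl]
    · right; ring
    · left; ring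

end Summit.BirchSwinnertonDyer.BirchSwinnertonDyer.Theorems.SignedMuAtTwo
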